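import Summits.QuantumFields.BalabanUV.Beta.GAN24.BorderedFrameInverseBlocks

/-!
# `BalabanUV.Beta.GAN24.ArrowUnitBlock` — binder row G-an2-4 / (CONV-C), road P1-fibre, row **P1-L10** `FibreStrip` ((I3′)), cut «(M4) scaled alias-space
# Neumann, two anchors» = SKELETON-P1 A5 v0.3 (`HOME/b2b-balaban-gan24-formalise-leaf-16/L10-CUT-M4.md`), module **F1d**: THE UNIT KKT BLOCK
# `[[2(1 − u uᴴ), −u],[uᴴ, 0]]` of a unit vector `u` — the shape of EVERY scaled alias block at a real anchor (`ArrowScaling.scaledArrow_T_ofRealVec`)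
# — is E1's frame model `frameModel (2(1 − u uᴴ)) u 0 (−1) 1` with transverse coercivity `τ = 2`; hence invertible with **`‖inverse‖ ≤ 5/2`** (one call of E1).

NOT IN PRINT; OUR PROOF ATTEMPT (of the road; THIS file is [folklore] finite-dimensional linear algebra over Mathlib + E1 `BorderedFrameInverse(+Blocks)` only).
HONEST FRAMING (cell contract, verbatim): «discharging `BetaPertH` makes Bałaban's UV stability UNCONDITIONAL — a real constructive-QFT result;
it is NOT the continuum limit and NOT the Clay problem.»  HONEST DEPENDENCY (verbatim): «continuum YM on T⁴ ⇐ BetaPertH ∧ nine spine estimates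
(0/9 proved); BetaPertH ⇐ (D1) ∧ (D4) ∧ CAP+tail; G-an2-4 gates asym, D1 and NE2/3/4.»  No cited fact, no wall binder, no `def … : Prop` hypothesis;
nothing of the K-slot of (CONV-C) is discharged here.  NOT summit progress.  This is the constant `tB = 5/2` of rows F3 (inner anchor) and F5 (outer anchor).
-/

noncomputable section

open Matrix WithLp Complex Finset
open scoped Matrix.Norms.L2Operator InnerProductSpace BigOperators ComplexConjugate
open Summit.QuantumFields.BalabanUV.Beta.GAN24.BorderedFrameInverse (uuH uuH_mulVec vecMul_uuH frameModel frameInv isUnit_frameModel inv_frameModel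
  isUnit_aug inj_of_coercive re_star_dotProduct_self sum_norm_sq_eq_norm_toLp)
open Summit.QuantumFields.BalabanUV.Beta.GAN24.BorderedFrameInverseBlocks (norm_frameInv_le norm_star_dotProduct_le)

namespace Summit.QuantumFields.BalabanUV.Beta.GAN24.ArrowUnitBlock

variable {ι : Type*} [Fintype ι] [DecidableEq ι]

/-- [folklore] **THE UNIT KKT BLOCK** of a vector `u`: `[[2(1 − u uᴴ), −u],[uᴴ, 0]] = frameModel (2(1 − u uᴴ)) u 0 (−1) 1` (E1's frame model with
transverse block `2(1 − u uᴴ)`, longitudinal entry `ε = 0`, border `α = −1`, `β = 1`). -/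
def unitKKT (u : ι → ℂ) : Matrix (ι ⊕ Unit) (ι ⊕ Unit) ℂ := frameModel ((2 : ℂ) • (1 - uuH u)) u 0 (-1) 1

omit [Fintype ι] in
/-- [folklore] Entries of the unit KKT block: `(inl κ, inl l) ↦ 2(δ_{κl} − u_κ conj(u_l))`, `(inl κ, inr) ↦ −u_κ`, `(inr, inl l) ↦ conj(u_l)`, `(inr, inr) ↦ 0`. -/
theorem unitKKT_apply_inl_inl (u : ι → ℂ) (κ l : ι) :
    unitKKT u (Sum.inl κ) (Sum.inl l) = 2 * ((if κ = l then 1 else 0) - u κ * conj (u l)) := by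
  simp [unitKKT, frameModel, fromBlocks_apply₁₁, uuH, vecMulVec_apply, one_apply, mul_sub, smul_eq_mul]

omit [Fintype ι] in
/-- [folklore] The `φ`/`c`-type column entry `−u_κ`. -/
theorem unitKKT_apply_inl_inr (u : ι → ℂ) (κ : ι) (v : Unit) : unitKKT u (Sum.inl κ) (Sum.inr v) = -u κ := by
  simp [unitKKT, frameModel, fromBlocks_apply₁₂]

omit [Fintype ι] in
/-- [folklore] The row entry `conj(u_l)`. -/
theorem unitKKT_apply_inr_inl (u : ι → ℂ) (v : Unit) (l : ι) : unitKKT u (Sum.inr v) (Sum.inl l) = conj (u l) := by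
  simp [unitKKT, frameModel, fromBlocks_apply₂₁]

omit [Fintype ι] in
/-- [folklore] The corner entry `0`. -/
theorem unitKKT_apply_inr_inr (u : ι → ℂ) (v w : Unit) : unitKKT u (Sum.inr v) (Sum.inr w) = 0 := by
  simp [unitKKT, frameModel, fromBlocks_apply₂₂]

/-- [folklore] `2(1 − u uᴴ) u = 0` for a unit vector. -/
theorem transverse_mulVec_u {u : ι → ℂ} (hu : star u ⬝ᵥ u = 1) : ((2 : ℂ) • (1 - uuH u)) *ᵥ u = 0 := by
  rw [smul_mulVec, sub_mulVec, one_mulVec, uuH_mulVec, hu, one_smul, sub_self, smul_zero]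

/-- [folklore] `uᴴ · 2(1 − u uᴴ) = 0` for a unit vector. -/
theorem u_vecMul_transverse {u : ι → ℂ} (hu : star u ⬝ᵥ u = 1) : star u ᵥ* ((2 : ℂ) • (1 - uuH u)) = 0 := by
  rw [vecMul_smul, vecMul_sub, vecMul_one, vecMul_uuH, hu, one_smul, sub_self, smul_zero]

/-- [folklore] TRANSVERSE COERCIVITY with `τ = 2`: for `x ⊥ u`, `Re(xᴴ · 2(1 − u uᴴ) x) = 2 Σ ‖x i‖²`. -/
theorem coercive_two (u x : ι → ℂ) (hx : star u ⬝ᵥ x = 0) :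
    2 * (∑ i, ‖x i‖ ^ 2) ≤ (star x ⬝ᵥ (((2 : ℂ) • (1 - uuH u)) *ᵥ x)).re := by
  rw [smul_mulVec, sub_mulVec, one_mulVec, uuH_mulVec, hx, zero_smul, sub_zero, dotProduct_smul, smul_eq_mul,
    show (2 : ℂ) = ((2 : ℝ) : ℂ) by norm_num, Complex.re_ofReal_mul, re_star_dotProduct_self, sum_norm_sq_eq_norm_toLp]

/-- [folklore] **THE UNIT KKT BLOCK IS INVERTIBLE** (unit vector `u`). -/
theorem isUnit_unitKKT {u : ι → ℂ} (hu : star u ⬝ᵥ u = 1) : IsUnit (unitKKT u) := by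
  have hA := isUnit_aug hu (u_vecMul_transverse hu) (inj_of_coercive (τ := 2) two_pos (coercive_two u))
  exact isUnit_frameModel hu (transverse_mulVec_u hu) (u_vecMul_transverse hu) hA (by norm_num) one_ne_zero

/-- [folklore] Its inverse is E1's explicit `frameInv (2(1 − u uᴴ)) u 0 (−1) 1 = [[(1 − u uᴴ)/2, u],[−uᴴ, 0]]`. -/
theorem inv_unitKKT {u : ι → ℂ} (hu : star u ⬝ᵥ u = 1) : (unitKKT u)⁻¹ = frameInv ((2 : ℂ) • (1 - uuH u)) u 0 (-1) 1 := by
  have hA := isUnit_aug hu (u_vecMul_transverse hu) (inj_of_coercive (τ := 2) two_pos (coercive_two u))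
  exact inv_frameModel hu (transverse_mulVec_u hu) (u_vecMul_transverse hu) hA (by norm_num) one_ne_zero

/-- [folklore] **`‖(unitKKT u)⁻¹‖ ≤ 5/2`** (= `1/τ + 1/|β| + 1/|α| + |ε|/(|α||β|)` with `τ = 2`, `α = −1`, `β = 1`, `ε = 0`; E1's `norm_frameInv_le`).
This is the ABSOLUTE block constant `tB` of the two anchors of the cut (rows F3, F5). -/
theorem norm_inv_unitKKT_le {u : ι → ℂ} (hu : star u ⬝ᵥ u = 1) : ‖(unitKKT u)⁻¹‖ ≤ 5 / 2 := by
  rw [inv_unitKKT hu]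
  have h := norm_frameInv_le (ε := (0 : ℂ)) (α := (-1 : ℂ)) (β := (1 : ℂ)) hu (transverse_mulVec_u hu) (u_vecMul_transverse hu) two_pos
    (coercive_two u)
  norm_num at h
  exact h

omit [DecidableEq ι] in
/-- [folklore] The unit-vector hypothesis in the cell's sum currency: `Σ_i ‖u i‖² = 1 ⇒ uᴴu = 1`. -/
theorem star_dotProduct_self_eq_one_of_sum {u : ι → ℂ} (h : ∑ i, ‖u i‖ ^ 2 = 1) : star u ⬝ᵥ u = 1 := by
  have hre : (star u ⬝ᵥ u).re = 1 := by rw [re_star_dotProduct_self, ← sum_norm_sq_eq_norm_toLp, h]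
  have him : (star u ⬝ᵥ u).im = 0 := by
    rw [dotProduct, Complex.im_sum]
    refine Finset.sum_eq_zero fun i _ => ?_
    rw [Pi.star_apply, Complex.star_def, Complex.conj_mul', ← Complex.ofReal_pow, Complex.ofReal_im]
  exact Complex.ext hre him

/-- [folklore] **SUM-CURRENCY FORM**: `Σ_i ‖u i‖² = 1 ⇒ IsUnit (unitKKT u) ∧ ‖(unitKKT u)⁻¹‖ ≤ 5/2`. -/
theorem isUnit_and_norm_inv_unitKKT_le {u : ι → ℂ} (h : ∑ i, ‖u i‖ ^ 2 = 1) : IsUnit (unitKKT u) ∧ ‖(unitKKT u)⁻¹‖ ≤ 5 / 2 :=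
  ⟨isUnit_unitKKT (star_dotProduct_self_eq_one_of_sum h), norm_inv_unitKKT_le (star_dotProduct_self_eq_one_of_sum h)⟩

end Summit.QuantumFields.BalabanUV.Beta.GAN24.ArrowUnitBlock

end
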